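import Mathlib
import HarnessLib
import HarnessLib.Audit
import Summits.Langlands.Statement
import Literature.NumberTheory.GaloisRepresentations.SymplecticMultiplier
import Literature.NumberTheory.GaloisRepresentations.ModPGaloisRep
import Literature.NumberTheory.GaloisRepresentations.CrystallineOrdinaryShape
import Literature.NumberTheory.DiophantineGeometry.AVGaloisModule
import Literature.AlgebraicGeometry.Motives.AbelianVariety
import HarnessLib.Audit.Status.Attr

/-!
Route: AbelianSurfaceSerre

DORMANT since 2026-08-24T13:50:46Z (reconciler: no traction for 6.8 d (last activity item-evidence-added at 2026-08-17T17:52:39Z); parked, not closed — `ledger route dormant route-Langlands-AbelianSurfaceSerre --off` to reactivate) — unstaffed, not closed; items shared with open routes are served there. `ledger route dormant <id> --off` reactivates.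

# Route AbelianSurfaceSerre — BCGP abelian-surface programme completed along its printed reduction —
Serre for GSp4 in regular ordinary weight (type A) + GL2-type surfaces over quadratic fields
(B[C2]), 2-3-switch anchor

PROGRAM-COMPLETION lens (LENSES-v3 §3.14). Programme: Boxer–Calegari–Gee–Pilloni, "all abelian
surfaces over ℚ are modular" (the irregular-weight, n = 4, F = ℚ, symplectic-motivic instance of
conjunct (B) of `Langlands`; BCGP 2021 = potential modularity, BCGP 2025 arXiv:2502.20645 Thm. 1.1 =
a positive proportion). The authors NAME the remaining step and PRINT the reduction: "a sufficiently
strong version of Serre's conjecture for GSp₄ in regular weight would be enough to prove the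
modularity of all abelian surfaces" (arXiv:2502.20645 p. 138) — Lemma 10.4.1 (§10.4, p. 146; Remark
10.4.2: "one could only demand the statement for p sufficiently large") and, in the programme
author's ICM 2026 survey (Gee, arXiv:2510.02756 §6 "Future directions", p. 17), "one other possible
route to the modularity of abelian surfaces would be to deduce it from an appropriate version of
Serre's conjecture for GSp₄ … analogous to Khare's theorem". It suffices to show X =
SerreGSp4Surjective ∧ QuadraticImprimitiveSurfaces: (K1) Serre's conjecture for GSp₄/ℚ in REGULAR
ORDINARY weight, level prime to p, for all sufficiently large p and all ρ̄ : Γ_ℚ → GSp₄(𝔽_p) with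
multiplier ε̄⁻¹, image ALL of GSp₄(𝔽_p) and ρ̄|Γ_(ℚ_p) triangularisable with distinct diagonal
characters — exactly the hypothesis of Lemma 10.4.1 at the residual images the proof (p. 146) uses
for the authors' first challenging Galois type **A** (End(A_ℚ̄) = ℤ); (K2) modularity of the
quadratically-imprimitive abelian surfaces over ℚ with End_ℚ(A) = ℤ — the authors' second
challenging type **B[C₂]**, for which they print the alternative reduction "the modularity of A
would follow from the modularity of E … remains open in general even for real quadratic fields K"
(Rem. 10.2.2; survey p. 4). The printed reduction enters BY NAME as the support item
BCGPSerreReduction (K1 → K2 → Target), the Target being modularity of every abelian surface over ℚ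
with End_ℚ(A) = ℤ (the cuspidal case of BCGP Def. 1.8.12; the 32 non-challenging Galois types are
Thm. 10.2.1, printed); the rest of the summit is the complement crux SurfaceSectorComplement (hub
convention for sector routes). No card is realised; the attack template for K1 is card
kw-induction-fontaine-empty-base (variant, unrouted), re-anchored (below).
Lean: `SerreGSp4Surjective ∧ QuadraticImprimitiveSurfaces`

## Assembly
Pure logic, CHECKED (Sketch.lean rc 0, 0 sorries; glue.lean = the deciding theorem): the printed
reduction hF : BCGPSerreReduction turns the two cruxes into the Target and the complement hJ carries
the Target to the summit constant by name: `closes h₁ h₂ hF hJ := hJ (hF h₁ h₂)`. Every binder is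
load-bearing (h₂ enters through hF).

Rationale: WHY THIS LINE. WHY THIS LINE. A published programme whose author names the gap and prints the
reduction theorem is the lens's object: `closes h₁ h₂ hF hJ := hJ (hF h₁ h₂)` is pure logic over
BCGP 2025 Lemma 10.4.1/Thm. 10.2.1 (support, cited by page) and the two cruxes are the authors' two
"challenging" Galois types. WHY-NOW, per gap. (K1, Serre for GSp₄ in regular ordinary weight, big
image): (i) a NON-VOID BASE CASE now exists at p = 3 — by arXiv:2502.20645 Lemma 9.4.2 + Thm. 8.3.2
(the 2–3 switch: P(ρ̄) is RATIONAL over ℚ for every ρ̄ : Γ_ℚ → GSp₄(𝔽₃) with multiplier ε̄⁻¹, Def.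
9.2.1, so a genus-2 Jacobian B/ℚ with B[3]^∨ ≅ ρ̄, good ordinary at 3, modular via its 2-adic
representation exists whenever ρ̄^∨|Γ_(ℚ₃) is ordinary finite flat and ρ̄|Γ_(ℚ₂) is unramified off
the classes 4C/12C; in tree as the named fact `bcgp_switch_exists_modular_abelianSurface`), residual
modularity of weight-two-shaped mod-3 symplectic representations holds WITH NO IMAGE HYPOTHESIS, and
Hida theory (BCGP 2021 §4–6) moves it to regular ordinary weight — the analogue of the Tate (p = 2)
/ Serre (p = 3) anchors of Khare–Wintenberger and of Wiles's 3–5 switch, discovered Feb. 2025 and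
not yet used as the base of an induction (searches below); (ii) geometric lifts of G-valued ρ̄ with
prescribed local conditions (Fakhruddin–Khare–Patrikis, Duke 2021) and weakly compatible systems
from potential automorphy (BLGGT 2014 §5; BCGP 2021 Thm. 9.x for abelian-surface type) replace KW's
Thm. 5.1; (iii) modularity lifting for GSp₄ in the abelian-surface weight at ordinary
p-distinguished primes INCLUDING p = 2, 3 (BCGP 2021 §7–8; 2025 §§6–8, Whitmore's vast/tidy images
2023) and in regular Fontaine–Laffaille / potentially diagonalisable weight through GL₄ + Arthur's
transfer (BLGGT; [A25–A27] closed by Atobe–Gan–Ichino–Kaletha–Mínguez–Shin 2024) replace Kisin's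
lifting theorems; (iv) weight shifting on Siegel threefolds (Hasse invariants: Boxer 2015,
Goldring–Koskivirta 2019; ordinary companion forms Gee–Geraghty 2012; Herzig–Tilouine 2013 weights)
replaces Edixhoven/Khare weight reduction. The KW engine for GL₂ needed exactly (anchor, lifts +
compatible systems, lifting theorems at every switching prime incl. 2 and 3, weight bookkeeping);
for GSp₄ over ℚ all four now exist in some printed form, and the chain can be run IN THE IRREGULAR
WEIGHT (2,2) where BCGP's theorems live, never needing a level-one void. (K2, GL₂-type surfaces over
quadratic fields): Freitas–Le Hung–Siksek 2015 (elliptic curves over real quadratic fields: the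
Res_(K/ℚ)E half of type B[C₂] over real K is a theorem ⇒ provable-now sub-case by automorphic
induction, Arthur–Clozel, tree facts `automorphicInduction_cyclic_cuspidal`), Caraiani–Newton 2023 +
Allen–Khare–Thorne (imaginary quadratic, most curves; residue hosted by route
FifteenLocusEisenstein), X(3)/X(5)-twist switching for GL₂-type surfaces whose RM field has a
degree-one prime over 3 or 5 (Ellenberg 2005 for 𝔽₉ images), and Moon–Taguchi/Dieulefait–Pacetti
residual anchors (route GoldenFieldSerre) — the printed open residue is RM fields with 3, 5, 7 all
inert. Imported areas: arithmetic of rational moduli spaces (weak approximation with thin-set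
avoidance, Lemma 9.4.1), higher Hida/Coleman theory and Pan-style classicality (2025 §4), G-valued
deformation theory. What no listed route does: 54 open headers read — the BCGP engine appears only
for OTHER motives (GSpinCensusRung rank 6, K3SpinSixteen, OccultE6Transport, TrigonalHeartLimit,
PicardMuOrdinary) or for the residually REDUCIBLE abelian-surface sector (PhantomRMYoshida,
complementary to K1's big image); no route files Serre-GSp₄ or abelian-surface modularity as a
load-bearing crux; GoldenFieldSerre runs KW for GL₂ over ℚ(√5) with void/Schoof anchors. Sources:
BoxerCalegariGeePilloni2025 (arXiv:2502.20645), arXiv:2510.02756, BoxerEtAl2021 (arXiv:1812.09269),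
KhareWintenberger2009, Khare2006, FakhruddinKharePatrikis2021, BarnetlambEtAl2014, GeeGeraghty2012,
HerzigTilouine2013, Whitmore2023, FreitasLeHungSiksek2015, CaraianiNewton2023, ArthurClozelAMS120,
Serre1987.

RANKED CRUXES. #0 EndTrivialSurfacesModular (target) — every abelian surface A/ℚ with End_ℚ(A) = ℤ
is modular: for every p, every framing r of H¹_ét(A_ℚ̄, ℚ̄_p) = (V_p A)^∨ ⊗ ℚ̄_p, every compactness
witness and every ι : ℚ̄_p ≃ ℂ there is an L-algebraic cuspidal π on GL₄(𝔸_ℚ) whose Satake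
parameters give the arithmetic-Frobenius characteristic polynomials of r at almost all places (the
cuspidal case of BCGP Def. 1.8.12 in the summit's L-normalisation, verbatim the modularity clause of
the accepted fact `bcgp_switch_exists_modular_abelianSurface`; surfaces with End_ℚ(A) ≠ ℤ have
reducible r and are modular by isobaric sums, Thm. 10.2.1). (why it might fail: believed
(paramodular conjecture, Brumer–Kramer); as TYPED it fails only through the API:
`HasSatakeParamAt`/`IsLAlgebraic` junk making ∃π unsatisfiable for genuine weight-2 transfers, or a
rank-≠-4 `rationalTateModule` making the ∀ b clause vacuous (then trivially true, misstated).)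
[arXiv:2502.20645, arXiv:1812.09269, BrumerKramer2014, BuzzardGeeLMS2014]
#2 SerreGSp4Surjective (crux) — (the author-named gap, type A) there is p₀ such that for every prime
p ≥ p₀ and every continuous ρ̄ : Γ_ℚ → GL₄(𝔽_p) preserving a non-degenerate alternating form J up to
the multiplier ε̄_p⁻¹ with image ALL of GSp(J)(𝔽_p), and with ρ̄|Γ_(ℚ_p) upper-triangularisable over
𝔽̄_p with pairwise distinct diagonal characters, there are a regular algebraic cuspidal π on
GL₄(𝔸_ℚ) unramified at p, ι : ℚ̄_p ≃ ℂ and a framed r : Γ_ℚ → GL₄(ℚ̄_p) Satake–Frobenius compatible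
with (π, ι) a.e. (Harris–Lan–Taylor–Thorne normalisation m = 4), of symplectic type,
crystalline-ordinary of strictly increasing shape at p, whose integral characteristic polynomials
reduce to those of ρ̄ ⊗ 𝔽̄_p (= "ρ̄ ≅ ρ̄_(π,p) for an ordinary cuspidal π of GSp₄/ℚ of regular
weight and level prime to p", BCGP 2025 Lemma 10.4.1 hypothesis with Rem. 10.4.2, restricted to the
residual images its proof uses for End(A_ℚ̄) = ℤ, p. 146: ρ̄(Γ_ℚ) = GSp₄(𝔽_p), residually
p-distinguished). [difficulty: open-problem] (why it might fail: "we do not know how to do this"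
(BCGP 2025 p. 4, on residual modularity beyond the switch); no symplectic Skinner–Wiles for
reducible residues mid-chain; at the anchor the chain must land ordinary at 3 and unramified at 2
off 4C/12C — conditions no congruence controls.) [arXiv:2502.20645, arXiv:2510.02756,
KhareWintenberger2009, Khare2006, FakhruddinKharePatrikis2021, arXiv:1812.09269, HerzigTilouine2013,
GeeGeraghty2012]
#3 QuadraticImprimitiveSurfaces (crux) — (the authors' second challenging type B[C₂], via their
printed alternative Rem. 10.2.2) every abelian surface A/ℚ with End_ℚ(A) = ℤ whose p-adic
representation r becomes REDUCIBLE over some quadratic field K (A_K of GL₂-type: RM by a real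
quadratic field, or isogenous to a product of conjugate elliptic curves; also the known
induced/potentially-abelian types) is modular in the sense of the Target — i.e. the Target
restricted to quadratically-imprimitive surfaces; open core printed: "the modularity of such abelian
surfaces remains open in general even for real quadratic fields K" (GL₂-type A_K with RM; and
elliptic curves over imaginary quadratic K beyond Caraiani–Newton). [difficulty: XL] (why it might
fail: contains modularity of ALL elliptic curves over ALL imaginary quadratic fields (open residue:
X₀(15)-type loci, residually reducible at 3 and 5) and of RM surfaces over real quadratic K with 3,
5, 7 inert in the RM field (no modular-curve switch); typed risk as for the Target.)
[arXiv:2502.20645, arXiv:2510.02756, FreitasLeHungSiksek2015, CaraianiNewton2023,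
AllenKhareThorne2021, Ellenberg2005, ArthurClozelAMS120]
#4 SurfaceSectorComplement (crux) — COMPLEMENT OF THE SECTOR = the rest of the summit:
`EndTrivialSurfacesModular → Langlands` — every n ≠ 4, every F ≠ ℚ, direction (A), the passage from
almost-everywhere matching to local–global compatibility at every place and to the reciprocity data
𝓡, every ρ not of abelian-surface type. Conjecture-grade, hence kinded crux and ranked last
(doctrine 2026-08-16: a sector is a component, the route must encompass the summit; convention of
GaloisWeightedBE/SkinnerWilesDefectOne/SqrtFiveQuarticCovers.SectorComplement); NOT where this
route's mechanism bites — graders judge #2/#3 and the Target; never staff it from this route.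
Implied by `Langlands` trivially (BC2 converse succeeds, recorded). [deps:
EndTrivialSurfacesModular] [difficulty: open-problem] (why it might fail: the rest of GL_n
reciprocity (all n, all F, direction (A), every place, 𝓡, irregular weights) is wide open;
`Langlands` as typed may over-claim in corners (even ρ, λ = 1/4 Maass π); imported complement.)
[BuzzardGeeLMS2014, FontaineMazurGeometric1995, Calegari2023]
#9 BCGPSerreReduction (support) — [printed theorem, consumed form] K1 → K2 → Target:
Boxer–Calegari–Gee–Pilloni 2025, §10.4 Lemma 10.4.1 ("Serre's Conjecture in regular weight implies
modularity") with Remark 10.4.2 (variant "p sufficiently large"), whose proof (p. 146) invokes the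
Serre hypothesis only at ρ̄ = ρ̄_(A,p) for p in the density-one set of BCGP 2021 (ordinary,
residually p-distinguished, vast and tidy) where ρ̄_(A,p)(Γ_ℚ) = GSp₄(𝔽_p) for Galois type A — this
is K1 — together with Theorem 10.2.1 (all 32 non-challenging Galois types are modular,
unconditionally) and Remark 10.2.2 / Def. 1.8.12 (type B[C₂] ⊂ the quadratically-imprimitive
surfaces, asserted modular by K2 outright). Inputs of the printed proof: Thm. 7.5.x
(`rho-is-modular-from-mult-one-and-classicity`), Prop. 7.5.y (p ∈ {2,3} and general p), the
classicality Theorem 4.12.x, Arthur's transfer GSp₄ ↔ GL₄ (§1.8.10; [A25–A27] now AGIKMS 2024; the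
twisted weighted fundamental lemma is the one cited result without an available proof, §1.6). To be
re-filed `(h : Fact) →` when a facts worker vends it (cite item filed at open). [difficulty:
provable-now] [arXiv:2502.20645, arXiv:1812.09269, arXiv:2510.02756]

TWO-LAYER PLAN. K1 ⇐ TransferToWeightTwo → WeightTwoSerre → K1 (birth skeleton
bc/SerreGSp4Surjective_birth.lean, rc 0, sorries = 2 stubs): TransferToWeightTwo = KW transfer (lift
ρ̄ to a regular ordinary geometric ρ by FKP, compatible system by BLGGT/BCGP 2021, reduce at a
switching prime P where the system has weight-two ordinary P-distinguished big-image shape, lift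
back by BCGP 2021 §7 + Hida theory) giving (ModOrdReg P ρ̄' → ModOrdReg p ρ̄); WeightTwoSerre =
Serre for GSp₄/ℚ for big-image ρ̄' of weight-two ordinary shape (the residual paramodular
statement), itself foreseen as ChainToThree (KW killing-ramification/prime-switching in weight (2,2)
down to P = 3 with the conditions at 2 and 3) → Anchor3 (support, theorem-level:
`bcgp_switch_exists_modular_abelianSurface` + Hida family regular members + Hasse-invariant weight
shift). K2 ⇐ RealQuadraticGL2Type → ImaginaryQuadraticGL2Type → K2 (birth skeleton
bc/QuadraticImprimitiveSurfaces_birth.lean, rc 0): case split on the signature of K; the real half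
further splits into ResOfEllipticReal (provable now from FLS + AI once vendored) and RMSurfacesReal
(open residue: RM field with 3, 5, 7 inert). Complement ⇐ ToReciprocityOverQ → AscentFromQ
(bc/SurfaceSectorComplement_birth.lean, rc 0; the ascent stub is the thesis of routes
TwistAveragedDeinduction/BaseFieldAscent). Nothing here is filed now.

KILL CRITERIA. (a) A certified mismatch between the L-function of one LMFDB genus-2 Jacobian with
End = ℤ and every weight-2 paramodular newform of its conductor (Poor–Yuen tables, N < 1000) refutes
the Target (close `refuted:EndTrivialSurfacesModular`; it would also falsify the printed Lemma's
conclusion and the paramodular conjecture — maximal information). (b) A big-image ρ̄ mod p ≥ p₀ with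
locally triangular distinguished shape provably admitting NO regular-ordinary automorphic lift
unramified at p refutes K1: if the witness is a normalisation artefact (multiplier parity, m = 4 vs
L-normalisation, shape sign) it is `refuted-misstated` and K1 is re-filed as K1R with the corrected
clause (the proof-form fact survives); if substantive (Serre for GSp₄ false in regular ordinary
weight) the Serre path of the programme is dead and the route pivots to the author's other named
continuation — Gee ICM 2026 §6 (F1) "extend Theorem 1.1 to totally real fields ⇒ remove the
hypothesis at 2 by solvable base change" and (F2) "small slope instead of ordinary ⇒ relax the
hypothesis at 3" — filed as new cruxes with a new printed-reduction support, or closes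
`refuted:SerreGSp4Surjective` if those do not reach the Target. (c) A GL₂-type abelian surface over
a quadratic field shown non-automorphic refutes K2 and conjunct (B) of the summit over that field
(route and summit die together there). (d) Mooted (close `superseded`) if a BCGP sequel proves
modularity of all abelian surfaces over ℚ, or if Serre's conjecture for GSp₄ is proved elsewhere.

NOT DECOMPOSED YET. The KW chain inside K1 (which switching primes, the exact weight-two ordinary
local condition with "nebentypus", the tame auxiliary prime keeping residual images big, the
treatment of ramification at 2 before the anchor, the Frobenius-at-2 class condition mod 3 and its
semistable-ordinary variant §9.2), the ordinary-companion step from weight (2,2) to regular weight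
(Hida family vs Hasse invariant ×(weight p−1)), and the three sub-cases of K2 (Res of elliptic
curves over real K — provable now modulo vendoring FLS + AI; RM over real K; imaginary K) are
layer-2 children, filed only when a crux closes or a prover asks (D-0019). No Literature facts are
vendored at open: Lemma 10.4.1/Thm. 10.2.1 enter as the support item BCGPSerreReduction (cite item
requested), the anchor as the existing fact `bcgp_switch_exists_modular_abelianSurface`.

CHEAPEST FALSIFIER. (i) PAPER CHECK (refuter, < 1 h): take a modular abelian surface from BCGP 2025
Thm. 1.1 (e.g. the LMFDB curve 277.a, or any of the 11743 curves of §10.1) and an ordinary prime p ≥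
5 of surjective mod-p image; K1's conclusion must then be TRUE for ρ̄ = ρ̄_(A,p) via the Hida family
through A's weight-2 form — verify that the typed clauses (HLTT normalisation m = 4,
`IsCrystallineOrdinaryOfShapeAt` with a strictly increasing non-negative shape, symplectic
multiplier, residual charpoly reduction with NO Tate twist) are simultaneously satisfiable by r =
r_(ℓ,ι)(Π ⊗ |det|^k) for the right k; a sign/normalisation clash is the cheapest misstated-kill and
is repairable. (ii) LOOKUP (not run here: hub compute-free, data not held): LMFDB genus-2 curves
with End = ℤ vs Poor–Yuen paramodular newform dimensions for N < 1000 — any certified mismatch kills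
the Target. (iii) IN-LEAN (ran): BC2 probes `C → Langlands` fail for all three cruxes (rc 1), BC4
`exact?` fails for all five items against Mathlib + cone + 71 Theses files (rc 1) — no crux is
cheaply the summit or a known theorem; `ledger negatives` (3 entries) untouched.

NUMBERS. |GSp₄(𝔽₃)| = 103680, |Sp₄(𝔽₃)| = 51840; PGSp₄(𝔽₃) ∖ PSp₄(𝔽₃) classes 4C, 12C are the two
excluded Frobenius-at-2 classes (Lemma 9.1.3). Proportion of genus-2 curves meeting Thm. 1.1 under
equidistribution mod 2, 3: 5551/46656 ≈ 0.119 (survey Rem. 2); LMFDB: 11743 of 66158 curves (2025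
§10.1), 11384 of 63107 with End = ℤ (survey). Hodge–Tate weights: weight-k Siegel eigenforms 0, k−2,
k−1, 2k−3 (regular iff k ≥ 3); abelian surfaces 0,0,1,1 (survey §2). Fontaine's bound rd <
p^(1+1/(p−1)) for finite flat level-1 ρ̄: 5.20 (p = 3), 7.48 (p = 5), 9.68 (p = 7) < Odlyzko 22.38 ⇒
the level-one weight-two-type base is EMPTY for p ≤ 7 (Fontaine 1985, Abrashkin) — the void the card
kw-induction-fontaine-empty-base uses; this route's anchor at 3 is non-void and image-blind instead.
KW's induction over ℚ used anchors p = 2 (Tate), 3 (Serre), 5, 7 (Schoof/Brueggeman–Khare) and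
Kisin's 2-adic lifting; here p = 3 (2–3 switch) and p = 2 (BCGP 2025 §10.3: A₅, A₆, S₆ images).
Items at open: 6 (target, 3 cruxes, 1 support, assembly).

DEFINITION REQUESTS. None needed to type the items (all over existing declarations: FramedGaloisRep,
FramedRep.charpoly/IsIrreducible/restrictField, IsSymplecticWithMultiplierFun,
modPCyclotomicCharacterZMod, toLocal, IsCrystallineOrdinaryOfShapeAt,
AbelianVariety/dim/rationalTateModule/rationalTateRep, CuspidalAutomorphicRepData, IsLAlgebraic,
IsRegularAlgebraic, IsUnramifiedAt, HasSatakeParamAt, arithFrobPolyOfSatake, PadicAlgCl, Valued.v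
valuation subring, AlgebraicClosure (ZMod p)). Cite facts wanted (filed as cite items at open, not
blocking): "fact: BCGP2025 Lemma 10.4.1 + Rem. 10.4.2 (Serre regular ordinary ⇒ all abelian surfaces
over ℚ modular)", "fact: BCGP2025 Thm. 10.2.1 (non-challenging Galois types modular)", "fact:
BCGP2021 Hida theory — regular-weight classical ordinary specialisations of the Hida family through
an ordinary weight-2 cuspidal Siegel eigenform", "fact: FreitasLeHungSiksek2015 Thm. 1 (elliptic
curves over real quadratic fields are modular)".

Novelty: Searches (2026-08-17): `lit search` local index × 4 (daemon ConnectionReset each time — unavailable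
this session), `--source openalex` / `arxiv` / `s2` (HTTP 429 rate-limited, 0 rows), `--source
zbmath "Serre conjecture GSp(4) mod p Siegel modular forms residual modularity"` (0); `lit galaxy
search "Serre's conjecture for GSp4" --star all` (0/0/0), `"Serre weight conjectures for GSp4"
--star all` (0), `"Serre-type conjecture" --star pdf` (9: Herzig tame GL_n weights, Le–Le
Hung–Levin–Morra U(3), Breuil–Herzig–Hu–Morra–Schraen GL₂ — none on GSp₄ residual modularity),
`"formes compagnons pour GSp" --star all` (1, Herzig), `"paramodular conjecture" --star pdf` (4:
Oberwolfach 2024 report, Rockwood thesis, Florit TFM, ANT masthead), `"residual modularity of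
abelian surfaces"` (0), `"Khare-Wintenberger method for GSp"` (0); `lit citing arXiv:2502.20645` (1:
higher Hida for Drinfeld curves) and `lit citing arXiv:1812.09269` (81; scanned 30: found and READ
the programme author's ICM 2026 survey arXiv:2510.02756 §§1–2, 5–6 incl. its Lemma 3 = Lemma 10.4.1
and "Future directions"; arXiv:2011.00158 mod-p representations not from abelian varieties; Whitmore
2026 TW for reductive groups; arXiv:2502.02044 mod-3 images); `lit read arXiv:2502.20645` pp. 1–12,
121–147 (§§1, 1.8, 8.3, 9.4, 10.1–10.4 at page level); in-house: all 54 open route headers of the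
sub (50 in hosting_routes.jsonl + PrimeSwitchSplit, HeckeFieldDeRham, SexticResolventInduction,
DedekindQuotient1951 opened during the se  [refs: 2502.20645, 1812.09269, 2510.02756, 2011.00158, 2502.02044, KhareWintenberger2009, Khare2006]

Barriers (technique_class: kw-induction, prime-switching, gsp4-lifting): - technique_class: kw-induction, prime-switching, gsp4-lifting
- Literature.Barriers.Langlands.TaylorWilesNumericalCoincidence: evaded — K1 lives on GSp₄/ℚ, odd
and polarised, where (CHT) holds (`l₀ = 0`; Clozel–Harris–Taylor's own "one can expect positive
results if G = GSp_2n", quoted in the barrier file); in the irregular weight (2,2) the positive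
coherent defect is absorbed by higher Hida complexes (BCGP 2021 Calegari–Geraghty patching over ℚ;
2025 §7 ordinary Taylor–Wiles on single-degree higher Hida theories), the catalogued evasion; K2's
imaginary-quadratic half (l₀ = 1) uses the Calegari–Geraghty/10-author engines as Caraiani–Newton
do.
- Literature.Barriers.Langlands.TaylorWilesNumericalCoincidenceNarrow: same escape (self-dual odd
sector over ℚ; positive defect only in K2's Bianchi half, where the printed CN/AKT theorems are the
engine).
- Literature.Barriers.Langlands.PatchingLocalComponentBarrier: MET at the small switching primes —
the bet (as Kisin's 2-adic theorem sufficed for KW) is that the chain runs through ORDINARY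
p-distinguished weight-two components only, where BCGP prove R = T even at p = 2, 3 (2025 §§6–8:
Spec R_p^△[1/p] irreducible when residually p-distinguished, BCGP 2021 Prop. 7.4.x); the
non-ordinary residue is the author-named sequel (F2, small slope) and stays outside K1's skeleton
until then.
- Literature.Barriers.Langlands.PatchingLocalComponentBarrierNarrow: as above; no
potentially-crystalline component bookkeeping beyond ordinary/FL is ask

Novelty grade: variant — route-review (refuter; prior art = the route's own printed sources + in-hub twin, no broader search run): the load-bearing lever 'Serre for GSp₄ in regular ordinary weight ⇒ all abelian surfaces over ℚ modular' is PUBLISHED as such for this statement (BCGP2025 Lemma 10.4.1, Rem. 10.4.2; named as a r (refuter refuter-rreview-0817T02-3-0, 2026-08-17T02:34:53Z; prior: arXiv:2502.20645 §10.4 Lemma 10.4.1 + Rem. 10.4.2 (BCGP2025), arXiv:2510.02756 §6 (Gee ICM2026 'Future directions'), route-Langlands-RegularSerreAbelianSurfaces, card kw-induction-fontaine-empty-base (graded variant))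

History (route lifecycle, newest last):
- 2026-08-17T02:25:19Z · rev 2: restated Assembly (stmt-Langlands-17769) — route-repair: restate the Assembly item (stmt-Langlands-17769). Old `K1 → K2 → BCGPSerreReduction → SurfaceSectorComplement → Langlands` is a propositional taut (planner-rrepair-Langlands-AbelianSurfaceSerre-878358f2-0)
- 2026-08-24T13:50:46Z · DORMANT — reconciler: no traction for 6.8 d (last activity item-evidence-added at 2026-08-17T17:52:39Z); parked, not closed — `ledger route dormant route-Langlands-Abelia (operator:999:2365880)

sub-problem: Langlands · status: dormant · opened planner-plan-lens3-Langlands-complete-0 2026-08-17T02:09:15Z · rev 5 · ledger route-Langlands-AbelianSurfaceSerre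
GENERATED by the gate from the ledger (D-0016/17). Provers cite these decls: `theorem foo : Summit.Langlands.Langlands.Theses.AbelianSurfaceSerre.<Decl> := …` in Summits/Langlands/Langlands/Theorems/<Name>.lean.
-/

namespace Summit.Langlands.Langlands.Theses.AbelianSurfaceSerre

open scoped BigOperators Topology Manifold Classical MeasureTheory ProbabilityTheory Matrix InnerProductSpace ComplexConjugate ContinuousMap
open Filter Set Function TopologicalSpace MeasureTheory

attribute [summit_statement] _root_.Langlands

/-- item stmt-Langlands-17764 · target · rank 0 · open · by planner
why it might fail: believed (paramodular conjecture, Brumer–Kramer); as TYPED it fails only through the API: `HasSatakeParamAt`/`IsLAlgebraic` junk making ∃π unsatisfiable for genuine weight-2 transfers, or a rank-≠-4 `rationalTateModule` making the ∀ b clause vacuous (then trivially true, misstated).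
sources: arXiv:2502.20645, arXiv:1812.09269, BrumerKramer2014, BuzzardGeeLMS2014
[target] every abelian surface A/ℚ with End_ℚ(A) = ℤ is modular: for every p, every framing r of
H¹_ét(A_ℚ̄, ℚ̄_p) = (V_p A)^∨ ⊗ ℚ̄_p, every compactness witness and every ι : ℚ̄_p ≃ ℂ there is an
L-algebraic cuspidal π on GL₄(𝔸_ℚ) whose Satake parameters give the arithmetic-Frobenius
characteristic polynomials of r at almost all places (the cuspidal case of BCGP Def. 1.8.12 in the
summit's L-normalisation, verbatim the modularity clause of the accepted fact
`bcgp_switch_exists_modular_abelianSurface`; surfaces with End_ℚ(A) ≠ ℤ have reducible r and are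
modular by isobaric sums, Thm. 10.2.1). -/
@[route_item "route-Langlands-AbelianSurfaceSerre"]
def EndTrivialSurfacesModular : Prop :=
  ∀ (A : Literature.AlgebraicGeometry.Motives.AbelianVariety ℚ), A.dim = 2 → (∀ f : A ⟶ A, ∃ n : ℤ, f = n • CategoryTheory.CategoryStruct.id A) → ∀ (p : ℕ) [Fact p.Prime] (b : Module.Basis (Fin 4) ℚ_[p] (A.rationalTateModule p)) (r : Literature.NumberTheory.GaloisRepresentations.FramedGaloisRep ℚ (PadicAlgCl p) 4), (∀ g : Field.absoluteGaloisGroup ℚ, (r g).val = ((LinearMap.toMatrix b b (A.rationalTateRep p g⁻¹)).map (algebraMap ℚ_[p] (PadicAlgCl p))).transpose) → ∀ (hcpt : Literature.NumberTheory.Automorphic.isCompact_glFiniteIntegralLevel 4 ℚ) (ι : PadicAlgCl p ≃+* ℂ), ∃ π : Literature.NumberTheory.Automorphic.CuspidalAutomorphicRepData 4 ℚ hcpt, π.1.IsLAlgebraic ∧ ∀ᶠ v : IsDedekindDomain.HeightOneSpectrum (NumberField.RingOfIntegers ℚ) in Filter.cofinite, ∃ a : Multiset ℂ, π.1.HasSatakeParamAt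 v a ∧ r.IsUnramifiedAt v ∧ r.HasFrobCharpolyAt v (Literature.NumberTheory.Automorphic.arithFrobPolyOfSatake ι v.residueCard 1 a)

/-- item stmt-Langlands-17765 · crux · rank 2 · open · by planner
why it might fail: "we do not know how to do this" (BCGP 2025 p. 4, on residual modularity beyond the switch); no symplectic Skinner–Wiles for reducible residues mid-chain; at the anchor the chain must land ordinary at 3 and unramified at 2 off 4C/12C — conditions no congruence controls.
sources: arXiv:2502.20645, arXiv:2510.02756, KhareWintenberger2009, Khare2006, FakhruddinKharePatrikis2021, arXiv:1812.09269
[crux] (the author-named gap, type A) there is p₀ such that for every prime p ≥ p₀ and every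
continuous ρ̄ : Γ_ℚ → GL₄(𝔽_p) preserving a non-degenerate alternating form J up to the multiplier
ε̄_p⁻¹ with image ALL of GSp(J)(𝔽_p), and with ρ̄|Γ_(ℚ_p) upper-triangularisable over 𝔽̄_p with
pairwise distinct diagonal characters, there are a regular algebraic cuspidal π on GL₄(𝔸_ℚ)
unramified at p, ι : ℚ̄_p ≃ ℂ and a framed r : Γ_ℚ → GL₄(ℚ̄_p) Satake–Frobenius compatible with (π,
ι) a.e. (Harris–Lan–Taylor–Thorne normalisation m = 4), of symplectic type, crystalline-ordinary of
strictly increasing shape at p, whose integral characteristic polynomials reduce to those of ρ̄ ⊗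
𝔽̄_p (= "ρ̄ ≅ ρ̄_(π,p) for an ordinary cuspidal π of GSp₄/ℚ of regular weight and level prime to p",
BCGP 2025 Lemma 10.4.1 hypothesis with Rem. 10.4.2, restricted to the residual images its proof uses
for End(A_ℚ̄) = ℤ, p. 146: ρ̄(Γ_ℚ) = GSp₄(𝔽_p), residually p-distinguished). [difficulty:
open-problem] -/
@[route_item "route-Langlands-AbelianSurfaceSerre", crux]
def SerreGSp4Surjective : Prop :=
  ∃ p₀ : ℕ, ∀ (p : ℕ) [Fact p.Prime], p₀ ≤ p → ∀ ρ : Literature.NumberTheory.GaloisRepresentations.FramedGaloisRep ℚ (ZMod p) 4, (∃ J : Matrix (Fin 4) (Fin 4) (ZMod p), J.transpose = -J ∧ IsUnit J.det ∧ (∀ g : Field.absoluteGaloisGroup ℚ, (ρ g).val.transpose * J * (ρ g).val = (((Literature.NumberTheory.GaloisRepresentations.modPCyclotomicCharacterZMod ℚ p g)⁻¹ : (ZMod p)ˣ) : ZMod p) • J) ∧ ∀ M : GL (Fin 4) (ZMod p), (∃ c : ZMod p, IsUnit c ∧ M.val.transpose * J * M.val = c • J) → M ∈ ρ.toMonoidHom.range)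 → (∀ v : IsDedekindDomain.HeightOneSpectrum (NumberField.RingOfIntegers ℚ), ((p : ℕ) : NumberField.RingOfIntegers ℚ) ∈ v.asIdeal → ∃ g : GL (Fin 4) (AlgebraicClosure (ZMod p)), (∀ (τ : Field.absoluteGaloisGroup (v.adicCompletion ℚ)) (i j : Fin 4), j < i → (g.val * ((ρ.toLocal v τ).val.map (algebraMap (ZMod p) (AlgebraicClosure (ZMod p)))) * (g⁻¹).val) i j = 0) ∧ ∀ i j : Fin 4, i ≠ j → ∃ τ : Field.absoluteGaloisGroup (v.adicCompletion ℚ), (g.val * ((ρ.toLocal v τ).val.map (algebraMap (ZMod p) (AlgebraicClosure (ZMod p)))) * (g⁻¹).val) i i ≠ (g.val * ((ρ.toLocal v τ).val.map (algebraMap (ZMod p) (AlgebraicClosure (ZMod p)))) * (g⁻¹).val) j j) → ∃ (hcpt : Literature.NumberTheory.Automorphic.isCompact_glFiniteIntegralLevel 4 ℚ) (π : Literature.NumberTheory.Automorphic.CuspidalAutomorphicRepData 4 ℚ hcpt) (ι : PadicAlgCl p ≃+* ℂ) (r : Literature.NumberTheory.GaloisRepresentations.FramedGaloisRep ℚ (PadicAlgCl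 p) 4), π.1.IsRegularAlgebraic ∧ (∀ v : IsDedekindDomain.HeightOneSpectrum (NumberField.RingOfIntegers ℚ), ((p : ℕ) : NumberField.RingOfIntegers ℚ) ∈ v.asIdeal → π.1.IsUnramifiedAt v ∧ ∃ a : Fin 4 → ℕ, StrictMono a ∧ r.IsCrystallineOrdinaryOfShapeAt v a) ∧ (∀ᶠ v : IsDedekindDomain.HeightOneSpectrum (NumberField.RingOfIntegers ℚ) in Filter.cofinite, ∃ a : Multiset ℂ, π.1.HasSatakeParamAt v a ∧ r.IsUnramifiedAt v ∧ r.HasFrobCharpolyAt v (Literature.NumberTheory.Automorphic.arithFrobPolyOfSatake ι v.residueCard 4 a)) ∧ (∃ ν : Field.absoluteGaloisGroup ℚ → PadicAlgCl p, r.IsSymplecticWithMultiplierFun ν) ∧ ∃ red : (Valued.v : Valuation (PadicAlgCl p) NNReal).valuationSubring →+* AlgebraicClosure (ZMod p), ∀ g : Field.absoluteGaloisGroup ℚ, ∃ P : Polynomial (Valued.v : Valuation (PadicAlgCl p) NNReal).valuationSubring, P.map (Valued.v : Valuation (PadicAlgCl p) NNReal).valuationSubring.subtype = Literature.NumberTheory.GaloisRepresentations.FramedRep.charpoly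 r g ∧ P.map red = (Literature.NumberTheory.GaloisRepresentations.FramedRep.charpoly ρ g).map (algebraMap (ZMod p) (AlgebraicClosure (ZMod p)))

/-- item stmt-Langlands-17766 · crux · rank 3 · open · by planner
why it might fail: contains modularity of ALL elliptic curves over ALL imaginary quadratic fields (open residue: X₀(15)-type loci, residually reducible at 3 and 5) and of RM surfaces over real quadratic K with 3, 5, 7 inert in the RM field (no modular-curve switch); typed risk as for the Target.
sources: arXiv:2502.20645, arXiv:2510.02756, FreitasLeHungSiksek2015, CaraianiNewton2023, AllenKhareThorne2021, Ellenberg2005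
[crux] (the authors' second challenging type B[C₂], via their printed alternative Rem. 10.2.2) every
abelian surface A/ℚ with End_ℚ(A) = ℤ whose p-adic representation r becomes REDUCIBLE over some
quadratic field K (A_K of GL₂-type: RM by a real quadratic field, or isogenous to a product of
conjugate elliptic curves; also the known induced/potentially-abelian types) is modular in the sense
of the Target — i.e. the Target restricted to quadratically-imprimitive surfaces; open core printed:
"the modularity of such abelian surfaces remains open in general even for real quadratic fields K"
(GL₂-type A_K with RM; and elliptic curves over imaginary quadratic K beyond Caraiani–Newton).
[difficulty: XL] -/
@[route_item "route-Langlands-AbelianSurfaceSerre"]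
def QuadraticImprimitiveSurfaces : Prop :=
  ∀ (A : Literature.AlgebraicGeometry.Motives.AbelianVariety ℚ), A.dim = 2 → (∀ f : A ⟶ A, ∃ n : ℤ, f = n • CategoryTheory.CategoryStruct.id A) → ∀ (p : ℕ) [Fact p.Prime] (b : Module.Basis (Fin 4) ℚ_[p] (A.rationalTateModule p)) (r : Literature.NumberTheory.GaloisRepresentations.FramedGaloisRep ℚ (PadicAlgCl p) 4), (∀ g : Field.absoluteGaloisGroup ℚ, (r g).val = ((LinearMap.toMatrix b b (A.rationalTateRep p g⁻¹)).map (algebraMap ℚ_[p] (PadicAlgCl p))).transpose) → (∃ (K : Type) (_ : Field K) (_ : NumberField K), Module.finrank ℚ K = 2 ∧ ¬ Literature.NumberTheory.GaloisRepresentations.FramedRep.IsIrreducible (r.restrictField K)) → ∀ (hcpt : Literature.NumberTheory.Automorphic.isCompact_glFiniteIntegralLevel 4 ℚ) (ι : PadicAlgCl p ≃+* ℂ), ∃ π : Literature.NumberTheory.Automorphic.CuspidalAutomorphicRepData 4 ℚ hcpt, π.1.IsLAlgebraic ∧ ∀ᶠ v : IsDedekindDomain.HeightOneSpectrum (NumberField.RingOfIntegers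 ℚ) in Filter.cofinite, ∃ a : Multiset ℂ, π.1.HasSatakeParamAt v a ∧ r.IsUnramifiedAt v ∧ r.HasFrobCharpolyAt v (Literature.NumberTheory.Automorphic.arithFrobPolyOfSatake ι v.residueCard 1 a)

/-- item stmt-Langlands-17767 · crux · rank 4 · open · by planner
why it might fail: the rest of GL_n reciprocity (all n, all F, direction (A), every place, 𝓡, irregular weights) is wide open; `Langlands` as typed may over-claim in corners (even ρ, λ = 1/4 Maass π); imported complement.
sources: BuzzardGeeLMS2014, FontaineMazurGeometric1995, Calegari2023
[crux] COMPLEMENT OF THE SECTOR = the rest of the summit: `EndTrivialSurfacesModular → Langlands` —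
every n ≠ 4, every F ≠ ℚ, direction (A), the passage from almost-everywhere matching to local–global
compatibility at every place and to the reciprocity data 𝓡, every ρ not of abelian-surface type.
Conjecture-grade, hence kinded crux and ranked last (doctrine 2026-08-16: a sector is a component,
the route must encompass the summit; convention of
GaloisWeightedBE/SkinnerWilesDefectOne/SqrtFiveQuarticCovers.SectorComplement); NOT where this
route's mechanism bites — graders judge #2/#3 and the Target; never staff it from this route.
Implied by `Langlands` trivially (BC2 converse succeeds, recorded). [deps:
EndTrivialSurfacesModular] [difficulty: open-problem] -/
@[route_item "route-Langlands-AbelianSurfaceSerre", crux]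
def SurfaceSectorComplement : Prop :=
  EndTrivialSurfacesModular → _root_.Langlands

/-- item stmt-Langlands-18072 · crux · rank 5 · open · by planner
why it might fail: Residual modularity for GSp₄ at induced images is open (BCGP2025 p.4 'we do not know how to do this'); the 2–3 switch Thm 9.5.1 needs Zariski ⊇ Sp₄, excluding Δ_p⋊C₂; as typed a slip in the pinned ε^{-(1+2s)}, p−1∣s / injective-shape clause would exclude the natural witness ρ_{π,p}⊗ε^{-s}.
sources: arXiv:2502.20645, arXiv:1812.09269, arXiv:2510.02756, KhareWintenberger2009, Serre1987
[crux] (K2's OPEN INPUT — layer-2 piece 1 of K2 = QuadraticImprimitiveSurfaces: verbatim the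
registered stub `stub_serreGSp4WreathFixed` of its skeleton Lines/Sketch.lean v3, filed as an item
on the line lead's promote-stub request; K2 ⇐ this + WreathReductionFixed by modus ponens) Serre's
conjecture for GSp₄/ℚ in REGULAR ORDINARY weight at the WREATH residues, GL₄ proxy, similitude of
the lift PINNED: there is P₀ such that for every prime p ≥ P₀, every algebraically closed discrete k
of characteristic p with a reduction map red : 𝒪(ℚ̄_p) → k, and every irreducible ρ̄ : Γ_ℚ → GL₄(k)
symplectic with multiplier ε̄_p⁻¹, upper-triangularisable on Γ_(ℚ_p) with pairwise distinct diagonal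
characters, with |ρ̄(Γ_ℚ)| = 2p²(p−1)(p²−1)² = |Δ_p ⋊ C₂|, irreducible on Γ_(ℚ(ζ_p)) and reducible
on Γ_K for some quadratic K — exactly the residues ρ̄_(A,p) of type-B[C₂] surfaces at large good
split primes used in the proof of BCGP 2025 Lemma 10.4.1, p. 146 — and every level witness and ι,
there are a REGULAR algebraic cuspidal π on GL₄(𝔸_ℚ) unramified at p and a framed r : Γ_ℚ →
GL₄(ℚ̄_p) symplectic with multiplier EXACTLY ε_p^(−(1+2s)) for some s with p−1 ∣ s,
Greenberg-ordinary of injective shape a -/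
@[route_item "route-Langlands-AbelianSurfaceSerre", crux]
def SerreGSp4WreathFixed : Prop :=
  ∃ P₀ : ℕ, ∀ (p : ℕ) [Fact p.Prime], P₀ ≤ p → ∀ (k : Type) [Field k] [CharP k p] [IsAlgClosed k] [TopologicalSpace k] [DiscreteTopology k] (red : Valued.integer (PadicAlgCl p) →+* k) (ρb : Literature.NumberTheory.GaloisRepresentations.FramedGaloisRep ℚ k 4), ρb.toGaloisRep.IsIrreducible → ρb.IsSymplecticWithMultiplierFun (fun g => (((Units.map (ZMod.castHom (dvd_refl p) k).toMonoidHom ((modularCyclotomicCharacter (AlgebraicClosure ℚ) (HasEnoughRootsOfUnity.natCard_rootsOfUnity (AlgebraicClosure ℚ) p)).comp (MulSemiringAction.toRingAut (Field.absoluteGaloisGroup ℚ) (AlgebraicClosure ℚ)) g))⁻¹ : kˣ) : k)) → (∀ v : IsDedekindDomain.HeightOneSpectrum (NumberField.RingOfIntegers ℚ), ((p : ℕ) : NumberField.RingOfIntegers ℚ) ∈ v.asIdeal → ∃ g : Matrix.GeneralLinearGroup (Fin 4) k, (∀ (τ : Field.absoluteGaloisGroup (v.adicCompletion ℚ)) (i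 j : Fin 4), j < i → (g * ρb.toLocal v τ * g⁻¹).val i j = 0) ∧ ∀ i j : Fin 4, i ≠ j → ∃ τ : Field.absoluteGaloisGroup (v.adicCompletion ℚ), (g * ρb.toLocal v τ * g⁻¹).val i i ≠ (g * ρb.toLocal v τ * g⁻¹).val j j) → Nat.card ρb.toMonoidHom.range = 2 * p ^ 2 * (p - 1) * (p ^ 2 - 1) ^ 2 → (ρb.restrictField (CyclotomicField p ℚ)).toGaloisRep.IsIrreducible → (∃ (K : Type) (_ : Field K) (_ : NumberField K), Module.finrank ℚ K = 2 ∧ ¬ (ρb.restrictField K).toGaloisRep.IsIrreducible) → ∀ (hcpt : Literature.NumberTheory.Automorphic.isCompact_glFiniteIntegralLevel 4 ℚ) (ι : PadicAlgCl p ≃+* ℂ), ∃ (π : Literature.NumberTheory.Automorphic.CuspidalAutomorphicRepData 4 ℚ hcpt) (r : Literature.NumberTheory.GaloisRepresentations.FramedGaloisRep ℚ (PadicAlgCl p) 4), π.1.IsRegularAlgebraic ∧ (∀ v : IsDedekindDomain.HeightOneSpectrum (NumberField.RingOfIntegers ℚ), ((p : ℕ) : NumberField.RingOfIntegers ℚ)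 ∈ v.asIdeal → π.1.IsUnramifiedAt v) ∧ (∃ s : ℕ, (p - 1) ∣ s ∧ r.IsSymplecticWithMultiplierFun (fun g => algebraMap ℚ_[p] (PadicAlgCl p) (((((Literature.NumberTheory.GaloisRepresentations.GaloisRep.cyclotomicCharacter ℚ p g)⁻¹ : ℤ_[p]ˣ) : ℤ_[p]) : ℚ_[p]) ^ (1 + 2 * s)))) ∧ (∀ v : IsDedekindDomain.HeightOneSpectrum (NumberField.RingOfIntegers ℚ), ((p : ℕ) : NumberField.RingOfIntegers ℚ) ∈ v.asIdeal → ∃ a : Fin 4 → ℕ, Function.Injective a ∧ r.IsGreenbergOrdinaryOfShapeAt v a) ∧ (∀ᶠ v : IsDedekindDomain.HeightOneSpectrum (NumberField.RingOfIntegers ℚ) in Filter.cofinite, ∃ α : Multiset ℂ, π.1.HasSatakeParamAt v α ∧ r.IsUnramifiedAt v ∧ r.HasFrobCharpolyAt v (Literature.NumberTheory.Automorphic.arithFrobPolyOfSatake ι v.residueCard 4 α)) ∧ (∀ᶠ v : IsDedekindDomain.HeightOneSpectrum (NumberField.RingOfIntegers ℚ) in Filter.cofinite, r.IsUnramifiedAt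 v ∧ ρb.IsUnramifiedAt v ∧ ∃ (P : Polynomial (Valued.integer (PadicAlgCl p))) (Pb : Polynomial k), r.HasFrobCharpolyAt v (P.map (Valued.integer (PadicAlgCl p)).subtype) ∧ ρb.HasFrobCharpolyAt v Pb ∧ P.map red = Pb)

/-- item stmt-Langlands-18078 · crux · rank 6 · open · by planner
why it might fail: Printed but XL (S5 = BCGP2025 Thm 7.5.8, §§2–7) and conditional in print on the twisted weighted FL (§1.6; Arthur for GSp₄ in S3/S5/S6); as typed the GL₄ witness must descend to a GSp₄ π of central character |·|², level prime to p — a 2nd normalisation slip would make it unprovable from print.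
sources: arXiv:2502.20645, arXiv:1812.09269, Arthur2013, GeeTaibi2019, Faltings1983Endlichkeit
[crux] (layer-2 piece 2 of K2 = QuadraticImprimitiveSurfaces; the printed reduction with the
similitude CORRECTED, PROMOTED from the XL named fact by route-choice 2026-08-17 so that crux rules
— lineage, one layer of 2–7 subs — apply; K2 ⇐ SerreGSp4WreathFixed + this by modus ponens)
SerreGSp4WreathFixed → QuadraticImprimitiveSurfaces, typed verbatim as the registered stub
`stub_wreathReductionFixed` (antecedent = body of SerreGSp4WreathFixed; Iff.rfl). In print: BCGP
2025 Lemma 10.4.1 along its proof p. 146 for Galois type B[C₂] (density-one good primes split in E,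
A ordinary and residually p-distinguished, ρ̄_(A,p)(Γ_K) = Δ_p, ρ̄_(A,p)(Γ_(ℚ(ζ_p∞))) = SL₂(𝔽_p) ≀
ℤ/2 [BCGP2021 §9.2]; 'ρ is modular from multiplicity one and classicity' Thm 7.5.8 with Prop 7.5.7 —
a fixed-similitude ε⁻¹ problem, whence the pinned multiplier and the twist ε^s, p−1 ∣ s; Cor 7.1.4;
Spec R_p^△[1/p] irreducible) ∘ descent GL₄ → GSp₄ (Prop 7.5.3(1), Arthur 2013 Thm 1.5.2, Gee–Taïbi
2019 §2) + Thm 10.2.1 (all Galois types ≠ A, B[C₂] modular unconditionally) + Faltings Satz 3–4 over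
K (End_ℚ(A) = ℤ ∧ r|Γ_K reducible ⟹ type ≠ A) + Serre–Tate/Weil ℓ-independence (every (p, b, r, ι)).
≡ (Iff.rfl) the accepted n -/
@[route_item "route-Langlands-AbelianSurfaceSerre", crux]
def WreathReductionFixed : Prop :=
  (∃ P₀ : ℕ, ∀ (p : ℕ) [Fact p.Prime], P₀ ≤ p → ∀ (k : Type) [Field k] [CharP k p] [IsAlgClosed k] [TopologicalSpace k] [DiscreteTopology k] (red : Valued.integer (PadicAlgCl p) →+* k) (ρb : Literature.NumberTheory.GaloisRepresentations.FramedGaloisRep ℚ k 4), ρb.toGaloisRep.IsIrreducible → ρb.IsSymplecticWithMultiplierFun (fun g => (((Units.map (ZMod.castHom (dvd_refl p) k).toMonoidHom ((modularCyclotomicCharacter (AlgebraicClosure ℚ) (HasEnoughRootsOfUnity.natCard_rootsOfUnity (AlgebraicClosure ℚ) p)).comp (MulSemiringAction.toRingAut (Field.absoluteGaloisGroup ℚ) (AlgebraicClosure ℚ)) g))⁻¹ : kˣ) : k)) → (∀ v : IsDedekindDomain.HeightOneSpectrum (NumberField.RingOfIntegers ℚ), ((p : ℕ) : NumberField.RingOfIntegers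 ℚ) ∈ v.asIdeal → ∃ g : Matrix.GeneralLinearGroup (Fin 4) k, (∀ (τ : Field.absoluteGaloisGroup (v.adicCompletion ℚ)) (i j : Fin 4), j < i → (g * ρb.toLocal v τ * g⁻¹).val i j = 0) ∧ ∀ i j : Fin 4, i ≠ j → ∃ τ : Field.absoluteGaloisGroup (v.adicCompletion ℚ), (g * ρb.toLocal v τ * g⁻¹).val i i ≠ (g * ρb.toLocal v τ * g⁻¹).val j j) → Nat.card ρb.toMonoidHom.range = 2 * p ^ 2 * (p - 1) * (p ^ 2 - 1) ^ 2 → (ρb.restrictField (CyclotomicField p ℚ)).toGaloisRep.IsIrreducible → (∃ (K : Type) (_ : Field K) (_ : NumberField K), Module.finrank ℚ K = 2 ∧ ¬ (ρb.restrictField K).toGaloisRep.IsIrreducible) → ∀ (hcpt : Literature.NumberTheory.Automorphic.isCompact_glFiniteIntegralLevel 4 ℚ) (ι : PadicAlgCl p ≃+* ℂ), ∃ (π : Literature.NumberTheory.Automorphic.CuspidalAutomorphicRepData 4 ℚ hcpt) (r : Literature.NumberTheory.GaloisRepresentations.FramedGaloisRep ℚ (PadicAlgCl p) 4), π.1.IsRegularAlgebraic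 ∧ (∀ v : IsDedekindDomain.HeightOneSpectrum (NumberField.RingOfIntegers ℚ), ((p : ℕ) : NumberField.RingOfIntegers ℚ) ∈ v.asIdeal → π.1.IsUnramifiedAt v) ∧ (∃ s : ℕ, (p - 1) ∣ s ∧ r.IsSymplecticWithMultiplierFun (fun g => algebraMap ℚ_[p] (PadicAlgCl p) (((((Literature.NumberTheory.GaloisRepresentations.GaloisRep.cyclotomicCharacter ℚ p g)⁻¹ : ℤ_[p]ˣ) : ℤ_[p]) : ℚ_[p]) ^ (1 + 2 * s)))) ∧ (∀ v : IsDedekindDomain.HeightOneSpectrum (NumberField.RingOfIntegers ℚ), ((p : ℕ) : NumberField.RingOfIntegers ℚ) ∈ v.asIdeal → ∃ a : Fin 4 → ℕ, Function.Injective a ∧ r.IsGreenbergOrdinaryOfShapeAt v a) ∧ (∀ᶠ v : IsDedekindDomain.HeightOneSpectrum (NumberField.RingOfIntegers ℚ) in Filter.cofinite, ∃ α : Multiset ℂ, π.1.HasSatakeParamAt v α ∧ r.IsUnramifiedAt v ∧ r.HasFrobCharpolyAt v (Literature.NumberTheory.Automorphic.arithFrobPolyOfSatake ι v.residueCard 4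 α)) ∧ (∀ᶠ v : IsDedekindDomain.HeightOneSpectrum (NumberField.RingOfIntegers ℚ) in Filter.cofinite, r.IsUnramifiedAt v ∧ ρb.IsUnramifiedAt v ∧ ∃ (P : Polynomial (Valued.integer (PadicAlgCl p))) (Pb : Polynomial k), r.HasFrobCharpolyAt v (P.map (Valued.integer (PadicAlgCl p)).subtype) ∧ ρb.HasFrobCharpolyAt v Pb ∧ P.map red = Pb)) → Summit.Langlands.Langlands.Theses.AbelianSurfaceSerre.QuadraticImprimitiveSurfaces

/-- item stmt-Langlands-17768 · support · rank 9 · open · by planner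
sources: arXiv:2502.20645, arXiv:1812.09269, arXiv:2510.02756
[support] [printed theorem, consumed form] K1 → K2 → Target: Boxer–Calegari–Gee–Pilloni 2025, §10.4
Lemma 10.4.1 ("Serre's Conjecture in regular weight implies modularity") with Remark 10.4.2 (variant
"p sufficiently large"), whose proof (p. 146) invokes the Serre hypothesis only at ρ̄ = ρ̄_(A,p) for
p in the density-one set of BCGP 2021 (ordinary, residually p-distinguished, vast and tidy) where
ρ̄_(A,p)(Γ_ℚ) = GSp₄(𝔽_p) for Galois type A — this is K1 — together with Theorem 10.2.1 (all 32
non-challenging Galois types are modular, unconditionally) and Remark 10.2.2 / Def. 1.8.12 (type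
B[C₂] ⊂ the quadratically-imprimitive surfaces, asserted modular by K2 outright). Inputs of the
printed proof: Thm. 7.5.x (`rho-is-modular-from-mult-one-and-classicity`), Prop. 7.5.y (p ∈ {2,3}
and general p), the classicality Theorem 4.12.x, Arthur's transfer GSp₄ ↔ GL₄ (§1.8.10; [A25–A27]
now AGIKMS 2024; the twisted weighted fundamental lemma is the one cited result without an available
proof, §1.6). To be re-filed `(h : Fact) →` when a facts worker vends it (cite item filed at open).
[difficulty: provable-now] -/
@[route_item "route-Langlands-AbelianSurfaceSerre", crux]
def BCGPSerreReduction : Prop :=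
  SerreGSp4Surjective → QuadraticImprimitiveSurfaces → EndTrivialSurfacesModular

-- earlier Assembly (stmt-Langlands-17769, replaced 2026-08-17T02:25:19Z -> stmt-Langlands-18281): retired by None — SerreGSp4Surjective → QuadraticImprimitiveSurfaces → BCGPSerreReduction → SurfaceSectorComplement → _root_.Langlands
/-- item stmt-Langlands-18281 · assembly · rank 1 · open · by planner
sources: arXiv:2502.20645
[assembly] SerreGSp4Surjective → QuadraticImprimitiveSurfaces → BCGPSerreReduction →
SurfaceSectorComplement → Langlands. -/
@[route_item "route-Langlands-AbelianSurfaceSerre", crux]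
def Assembly : Prop :=
  SerreGSp4Surjective → QuadraticImprimitiveSurfaces → SurfaceSectorComplement → _root_.Langlands

/-! D-0027 §2.1 — DECIDING THEOREM (planner-authored via `route open/edit --closes-file`; by planner-rrepair-Langlands-AbelianSurfaceSerre--2cf09de3-0 2026-08-17T11:45:08Z):
its hypotheses are this route's items and its conclusion the sub-problem Statement (glue_lint), and it elaborates with this file. -/

/-- DECIDING THEOREM (D-0027 §2.1) of route AbelianSurfaceSerre (re-wired 2026-08-17, route-repair
`glue.unused-crux`): the type-A Serre crux `SerreGSp4Surjective` (K1) enters the printed reduction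
`BCGPSerreReduction` (BCGP 2025 Lemma 10.4.1 + Rem. 10.4.2 + Thm. 10.2.1 + Rem. 10.2.2, support) directly;
the type-B[C₂] crux `QuadraticImprimitiveSurfaces` (K2) is now reached BY MODUS PONENS from its two
promoted layer-2 pieces — the wreath-residue Serre crux `SerreGSp4WreathFixed` and the similitude-pinned
printed wreath reduction `WreathReductionFixed : (body of SerreGSp4WreathFixed) → QuadraticImprimitiveSurfaces`
(`hR hW : QuadraticImprimitiveSurfaces`, definitional unfolding only) — and the complement crux
`SurfaceSectorComplement` carries the Target `EndTrivialSurfacesModular` to the summit by name.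
Pure logic; every binder is load-bearing; K2 and the Target are interior nodes of the cone (reached through
the statements of `WreathReductionFixed` / `BCGPSerreReduction`). -/
@[closes "route-Langlands-AbelianSurfaceSerre"] theorem closes (h₁ : SerreGSp4Surjective) (hW : SerreGSp4WreathFixed) (hR : WreathReductionFixed)
    (hF : BCGPSerreReduction) (hJ : SurfaceSectorComplement) : _root_.Langlands :=
  hJ (hF h₁ (hR hW))

end Summit.Langlands.Langlands.Theses.AbelianSurfaceSerre
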